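import Summits.QuantumAdvantage.QuantumAdvantage.Theses.ShorLocallyDark

/-!
# Route `ShorLocallyDark`: the support `SparseMultipleExists` (stmt-QuantumAdvantage-8597)

Calibration from above for the dark order of Shor's control register (van Lint, *Introduction to
Coding Theory*, §12.1, AN codes; folklore pigeonhole): every `0 < r < 2^n` divides a NONZERO
`{−1, 0, 1}`-combination of `2^0, …, 2^{2n−1}` of weight `≤ n + 1`.  Proof: the `2^{n+1} > r`
subsets `S` of the `n + 1` positions `0, …, n` (available since `n ≥ 1`) cannot have pairwise
distinct sums `∑_{j∈S} 2^j` modulo `r`; the difference of the indicator vectors of two colliding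
subsets is the required combination.

* `sparseMultipleExists_proof` — the item, by name.

HONEST FRAMING: a closed support item of a sibling route (elementary pigeonhole), NOT summit
progress; the route's cruxes are untouched.
-/

set_option linter.dupNamespace false -- D-0017: single-problem summit ⇒ `QuantumAdvantage.QuantumAdvantage` by design

namespace Summit.QuantumAdvantage.QuantumAdvantage.Theorems.ShorLocallyDark

open Summit.QuantumAdvantage.QuantumAdvantage.Theses.ShorLocallyDark

/-- **`ShorLocallyDark.SparseMultipleExists`** (stmt-QuantumAdvantage-8597): for `1 ≤ n` and
`0 < r < 2^n` there is `ε : Fin (2n) → {−1, 0, 1}`, `ε ≠ 0`, supported on at most `n + 1`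
positions, with `r ∣ ∑ ε_j 2^j` (pigeonhole on the subsets of the positions `≤ n`).
[cite: Vanlint1992, §12.1 (Problem 12.5.1)] [folklore] -/
theorem sparseMultipleExists_proof : SparseMultipleExists := by
  classical
  intro n r hn hr hrn
  haveI : NeZero r := ⟨hr.ne'⟩
  -- the positions `0, …, n` inside `Fin (2n)`
  let T : Finset (Fin (2 * n)) := Finset.univ.filter fun j => (j : ℕ) ≤ n
  have hTcard : T.card = n + 1 := by
    have himage : T = (Finset.range (n + 1)).attachFin (fun m hm => by
        have := Finset.mem_range.mp hm; omega) := by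
      ext j
      simp only [T, Finset.mem_filter, Finset.mem_univ, true_and, Finset.mem_attachFin,
        Finset.mem_range]
      omega
    rw [himage, Finset.card_attachFin, Finset.card_range]
  -- pigeonhole: two subsets of `T` with the same sum modulo `r`
  let f : Finset (Fin (2 * n)) → ZMod r := fun S => ∑ j ∈ S, (2 : ZMod r) ^ (j : ℕ)
  have hlt : (Finset.univ : Finset (ZMod r)).card < T.powerset.card := by
    rw [Finset.card_univ, ZMod.card, Finset.card_powerset, hTcard]
    calc r < 2 ^ n := hrn
      _ < 2 ^ (n + 1) := Nat.pow_lt_pow_right (by norm_num) (by omega)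
  obtain ⟨S, hS, S', hS', hne, hfeq⟩ :=
    Finset.exists_ne_map_eq_of_card_lt_of_maps_to hlt (f := f) (fun S _ => Finset.mem_univ _)
  have hST : S ⊆ T := Finset.mem_powerset.mp hS
  have hS'T : S' ⊆ T := Finset.mem_powerset.mp hS'
  -- the difference of the indicator vectors
  refine ⟨fun j => (if j ∈ S then (1 : ℤ) else 0) - (if j ∈ S' then 1 else 0), ?_, ?_, ?_, ?_⟩
  · intro j
    by_cases h1 : j ∈ S <;> by_cases h2 : j ∈ S' <;> simp [h1, h2]
  · -- nonzero: some position lies in exactly one of `S`, `S'`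
    intro hzero
    apply hne
    ext j
    have hj := congrFun hzero j
    simp only [Pi.zero_apply] at hj
    by_cases h1 : j ∈ S <;> by_cases h2 : j ∈ S' <;> simp [h1, h2] at hj ⊢
  · -- support inside `T`
    calc (Finset.univ.filter fun j : Fin (2 * n) =>
            (if j ∈ S then (1 : ℤ) else 0) - (if j ∈ S' then 1 else 0) ≠ 0).card
        ≤ T.card := by
          refine Finset.card_le_card fun j hj => ?_
          simp only [Finset.mem_filter, Finset.mem_univ, true_and] at hj
          by_contra hjT
          have h1 : j ∉ S := fun h => hjT (hST h)
          have h2 : j ∉ S' := fun h => hjT (hS'T h)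
          simp [h1, h2] at hj
      _ = n + 1 := hTcard
  · -- divisibility: the two sums agree modulo `r`
    rw [← ZMod.intCast_zmod_eq_zero_iff_dvd]
    push_cast
    simp only [sub_mul, Finset.sum_sub_distrib, ite_mul, one_mul, zero_mul, Finset.sum_ite_mem,
      Finset.univ_inter]
    exact sub_eq_zero.mpr hfeq

end Summit.QuantumAdvantage.QuantumAdvantage.Theorems.ShorLocallyDark
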